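import Summits.RiemannHypothesis.RiemannHypothesis.Theorems.TiltedLandingLaw421R3SinkCompose
import Summits.RiemannHypothesis.RiemannHypothesis.Theorems.TiltedLandingLaw421R3SinkCornerReduction

/-!
# «SinkCorner» v2 — (b): RIGHT-SIDED corner dominance ∘ 107, pre-wired BY NAME (C1 desk, rh-idea-5: cut g39, image g40; files-only; SUPPORT, K only;
consumer named by director-rh (CA1009)(3)/(CA1015)(1): the arrow «C′ ⇒ the lcert bound» of «Ends ∧ Kink ⇒ C′ ⇒ lcert bound ⇒ `CertificatesExistRightSig`»)

v2 vs v1 (93a81a14): hypothesis re-targeted from 102's unsided `CornerDominanceSig` (FALSE for left children — `RhW08.SinkMirrorNeg.not_cornerDominanceSig`,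
#1267) to 113's `CornerDominanceRSig` (#1266) with the extra binder `hright : xv ≤ w.re`; decls byte-identical to the g39 drawer 6f4c3f70.  TWO imports,
both TREE: 107 «SinkCompose» (#1259; carries 104, 102 and the Literature max principle) and 113 «CornerReduction» (#1266).
Namespace `RhW08.SinkCorner`; nothing re-declared.  (K) bookkeeping only: for a CONE child RIGHT of the axis, nested under a state below the box top,
`CornerDominanceRSig` (boundary domination of the real-part two-point family at `σ* = cornerSigma`) feeds 107's `sinkAssembly_of_bdry` directly — the
two-point family is admissible for `0 ≤ y0 ≤ 1` (`realTwoPoint_admissible`) and the child sits in the near window (`abs_re_lt_of_nested`).  Conclusion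
`Lcert (realTwoPoint …) G σ* ≤ L` for every read value `G` satisfying (E) and the two seam reads (`lcert_le_of_cornerDominanceR`); LEFT children go through
the mirror family (117 «SinkMirror» #1269, `RhW08.SinkMirror.certificatesExistSig_of_right`); the datum alternative (D) and the non-cone children are NOT
touched (C3's analysis).
LEVEL: SUPPORT (K).  Asserts no law (`CornerDominanceRSig` enters as a HYPOTHESIS).  No `sorry`.  Nothing here bears on the truth of RH; RH is not
proved; ⟨33346⟩/⟨33347⟩ OPEN; `CornerDominanceRSig` / `CertificatesExistSig` OPEN; checked ≠ keyed ≠ landed ≠ proved.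
-/

noncomputable section

open Complex
open scoped ComplexConjugate
open RhW08.SinkTemplate RhW08.SinkCornerReduction

namespace RhW08.SinkCorner

/-- the real-part two-point family is an admissible cut family for `0 ≤ y0 ≤ 1`. -/
theorem realTwoPoint_admissible (xv h y0 : ℝ) (w : ℂ) (h0 : 0 ≤ y0) (h1 : y0 ≤ 1) :
    CutsAdmissible xv (realTwoPoint xv h y0 w) := by
  unfold CutsAdmissible realTwoPoint
  refine ⟨Fin.forall_fin_two.2 ⟨⟨h0, by simp, rfl⟩, ⟨sub_nonneg.2 h1, by simp, rfl⟩⟩, ?_⟩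
  rw [Fin.sum_univ_two]
  show y0 + (1 - y0) = 1
  ring

/-- a child nested under a state of height `0 ≤ Im v ≤ h` with `3h < R` lies in the near window: `|Re w − xv| < R/2` (indeed `< R/3`). -/
theorem abs_re_lt_of_nested {xv R h : ℝ} {v w : ℂ} (h3 : 3 * h < R) (hv : 0 ≤ v.im) (hvh : v.im ≤ h)
    (hnest : (w.re - xv) ^ 2 + w.im ^ 2 ≤ v.im ^ 2) : |w.re - xv| < R / 2 := by
  have hh : v.im ^ 2 ≤ h ^ 2 := pow_le_pow_left₀ hv hvh 2
  have hR : h ^ 2 < (R / 2) ^ 2 := by nlinarith [mul_pos (show 0 < R / 2 - h by linarith) (show 0 < R / 2 + h by linarith)]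
  have h1 : (w.re - xv) ^ 2 < (R / 2) ^ 2 := by linarith [sq_nonneg w.im]
  exact abs_lt_of_sq_lt_sq h1 (by linarith)

/-- ★ (K) RIGHT-SIDED CORNER DOMINANCE ∘ 107: under the binders of 113's `CornerDominanceRSig` (cone child RIGHT of the axis `xv ≤ Re w`, nested,
shallow drop, `0 ≤ y0 ≤ 1`) and the assembly data
of 102/107 (far family in the maximal strip with nonnegative multiplicities, summabilities, (E), the two seam reads at the foot and the box top),
`CornerDominanceRSig` gives `Lcert (realTwoPoint xv h y0 w) G σ* ≤ L` with `σ* = cornerSigma xv R (realTwoPoint xv h y0 w) w`. -/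
theorem lcert_le_of_cornerDominanceR (hCD : CornerDominanceRSig) (ι : Type) (a : ι → ℂ) (m : ι → ℝ) (xv R s h y0 : ℝ)
    (v w G : ℂ) (L : ℝ)
    (hs : 0 < s) (hR6 : 6 * s ≤ R) (h3 : 3 * h < R) (hv : v.re = xv) (hY : 0 < v.im) (hYh : v.im ≤ h)
    (ht : 0 < w.im) (htY : w.im < v.im) (hdrop : v.im - s / 4 < w.im) (hnest : (w.re - xv) ^ 2 + w.im ^ 2 ≤ v.im ^ 2)
    (hcone : ConeChild xv R w) (hright : xv ≤ w.re) (hy0 : 0 ≤ y0) (hy1 : y0 ≤ 1)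
    (hm : ∀ i, 0 ≤ m i) (hstrip : ∀ i, MaxStrip xv R (a i))
    (hsum : ∀ k, Summable fun i =>
        m i * (conj (realTwoPoint xv h y0 w k).e * (farPairK (a i) w - farPairK (a i) (realTwoPoint xv h y0 w k).p)).re)
    (hsumc : Summable fun i => m i * farPairC w (a i))
    (hE : -G.im = ∑' i, m i * farPairC w (a i))
    (hseam : ∀ k, (conj (realTwoPoint xv h y0 w k).e * G).re
        - ∑' i, m i * (conj (realTwoPoint xv h y0 w k).e * (farPairK (a i) w - farPairK (a i) (realTwoPoint xv h y0 w k).p)).re ≤ L) :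
    Lcert (realTwoPoint xv h y0 w) G (cornerSigma xv R (realTwoPoint xv h y0 w) w) ≤ L :=
  RhW08.SinkCompose.sinkAssembly_of_bdry (Fin 2) ι a m xv R (realTwoPoint xv h y0 w) w G L _ hm hstrip
    (realTwoPoint_admissible xv h y0 w hy0 hy1) (abs_re_lt_of_nested h3 hY.le hYh hnest)
    (hCD xv R s h y0 v w hs hR6 h3 hv hY hYh ht htY hdrop hnest hcone hright hy0 hy1) hsum hsumc hE hseam

end RhW08.SinkCorner

end
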